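import Summits.BirchSwinnertonDyer.BirchSwinnertonDyer.Theorems.ResidualThetaTransportAtTwoSignedMuSeedAtTwoPlusTiltFormalGroup
import HarnessLib

/-!
# The LEVEL-ONE WALL: `S₁ = S₀ + S₀(t ⊕ y) ≡ (ūT₄² + ū²T₆)·t¹² (mod t¹⁴)` — the algebraic core of stub J4 `LevelOneWallCriterion`
# of the seed line `jet-character-sums` (crux `SignedMuSeedAtTwoPlus` stmt-BirchSwinnertonDyer-21438; Kμ⁺ stmt-BirchSwinnertonDyer-20689;
# route `ResidualThetaTransportAtTwo`), i.e. the card's cheapest falsifier (a) «v(S₁) = 13 or < 12 would expose a missed contribution» run SYMBOLICALLY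

Cell `bsd-wall`, width seat `bsd-wall-rtt-p4-w2` g13 (`--supports`, closes nothing).  THEOREMS ONLY (no `def`, no named fact, no instance,
no `sorry`); nothing about any curve, unit or `μ`-invariant is asserted; the line is NOT registered (W-79); BSD is not proved by this.

The card (`Cruxes/SignedMuSeedAtTwoPlus/Lines/jet-character-sums.md`, J4): «on `E₀ = 0` classes, `S₁ ≡ (ūT₄² + ū²T₆)t¹² (mod t¹⁴)` … hence
`NonDeg(1) ⟺ T₆ ≠ ū²T₄²` … Why it might fail: a missed `t¹²`-contribution».  Here the identity is a THEOREM of power-series algebra over any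
commutative ring of characteristic `2`, from exactly these inputs:
* `S` (the level-`0` series `S₀ = Φ_ρ`) with the RICCATI relation `S' = S²` (every `D log` in characteristic `2` with `η = 1`: `Z·S = Z'`
  gives `S' = S²`, tree `Tilt.mul_derivative_eq_sq_of_logDeriv`), `[t⁰]S = 0` (the degenerate level `0`: `E₀ = 0`) and `[t²]S = 0` (the
  `ρ`-symmetrisation kills `n ≡ 2 (mod 3)`, tree `coeff_rhoSymm_eq`);
* `δ := (t ⊕ y) − t` with **only** `δ ≡ ū·t⁴ (mod t⁸)` (from `t ⊕ y = t + η̄y + y²r`, tree `Tilt.exists_translate_eq`, `η̄ = 1`, and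
  `y = [g − 1]t = ([w₀]‾t)⁴ = ū t⁴ + O(t⁸)` by `[−2] = Frob₄`, tree `Tilt.formalNeg_subst_formalMul_two_of_charP` / `map_hom_one_add_pow_mul`).
No finer structure of `F`, `[−1]`, `𝒟₂`, `μ_c` is needed: the `t¹²`- and `t¹³`-coefficients of `S₁` see `δ` only modulo `t⁸`.

* §1 `coeff_one/three/five/seven_eq_zero_of_riccati`, `coeff_nine_eq_sq_of_riccati` — `T₁ = T₃ = T₅ = T₇ = 0`, `T₉ = T₄²` from `S' = S²`, `T₀ = T₂ = 0`.
* §2 `frobenius` bookkeeping: `(t + t⁴θ)ⁿ + tⁿ (mod t¹⁴)` for `n ∈ {4, 6, 8, …, 13}` in characteristic `2`.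
* §3 **`X_pow_fourteen_dvd_levelOne_sub`**: `t¹⁴ ∣ S + S(t + δ) − (ūT₄² + ū²T₆)·t¹²`; hence **`coeff_twelve_levelOne`** (`[t¹²]S₁ = ūT₄² + ū²T₆`),
  **`coeff_thirteen_levelOne`** (`[t¹³]S₁ = 0`: «`v(S₁)` is never `13`»), `coeff_levelOne_eq_zero_of_lt_twelve`, and the wall dichotomy
  **`levelOne_dichotomy`**: `v(S₁) ∈ {12} ∪ [14, ∞)` with `v(S₁) = 12 ⟺ ūT₄² + ū²T₆ ≠ 0` — for `ū ∈ 𝔽₄^×` (`ū³ = 1`) this is the card's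
  `NonDeg(1) ⟺ T₆ ≠ ū²T₄²` (multiply by `ū`).

References: the card (J4, «Why it might fail», cheapest falsifier (a)); [SilvermanAEC2009] IV.1 for context only.
-/

set_option autoImplicit false
-- the Theorems namespace of this sub repeats the summit name by design (D-0017 nested layout)
set_option linter.dupNamespace false

noncomputable section

open PowerSeries Finset

namespace Summit.BirchSwinnertonDyer.BirchSwinnertonDyer.Theorems.SignedMuAtTwo.JetCharacterSums

variable {k : Type*} [CommRing k] [CharP k 2]

/-! ## §1 The Riccati relation `S' = S²` with `T₀ = T₂ = 0` forces `T₁ = T₃ = T₅ = T₇ = 0`, `T₉ = T₄²` -/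

section Riccati

variable {S : k⟦X⟧} (hR : d⁄dX k S = S * S) (h0 : coeff 0 S = 0) (h2 : coeff 2 S = 0)

omit [CharP k 2] in
include hR in
/-- The coefficient identity `[tⁿ]S' = (n+1)·T_{n+1} = Σ_{i+j=n} TᵢTⱼ` of `S' = S²`. [folklore] -/
theorem coeff_succ_mul_eq_sum_of_riccati (n : ℕ) :
    coeff (n + 1) S * (n + 1) = ∑ i ∈ range (n + 1), coeff i S * coeff (n - i) S := by
  have h := congrArg (coeff n) hR
  rwa [coeff_derivative, coeff_mul, Nat.sum_antidiagonal_eq_sum_range_succ_mk] at h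

omit [CharP k 2] in
include hR h0 in
/-- `T₁ = T₀² = 0`. [folklore] -/
theorem coeff_one_eq_zero_of_riccati : coeff 1 S = 0 := by
  have h := coeff_succ_mul_eq_sum_of_riccati hR 0
  simp only [zero_add, Nat.cast_zero, mul_one, sum_range_one, Nat.sub_zero, h0, mul_zero] at h
  exact h

include hR h0 in
/-- `T₃ = T₁² = 0` (`3 = 1` in characteristic `2`). [folklore] -/
theorem coeff_three_eq_zero_of_riccati : coeff 3 S = 0 := by
  have h1 := coeff_one_eq_zero_of_riccati hR h0
  have h := coeff_succ_mul_eq_sum_of_riccati hR 2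
  simp only [sum_range_succ, sum_range_zero, h0, h1, mul_zero, zero_mul, add_zero, Nat.sub_zero,
    Nat.sub_self, show 2 - 1 = 1 from rfl] at h
  have h2k : (2 : k) = 0 := CharTwo.two_eq_zero
  linear_combination h - coeff 3 S * h2k

include hR h0 h2 in
/-- `T₅ = T₂² = 0`. [folklore] -/
theorem coeff_five_eq_zero_of_riccati : coeff 5 S = 0 := by
  have h1 := coeff_one_eq_zero_of_riccati hR h0
  have h3 := coeff_three_eq_zero_of_riccati hR h0
  have h := coeff_succ_mul_eq_sum_of_riccati hR 4
  simp only [sum_range_succ, sum_range_zero, h0, h1, h2, h3, mul_zero, zero_mul, add_zero, Nat.sub_zero,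
    Nat.sub_self, show 4 - 1 = 3 from rfl, show 4 - 2 = 2 from rfl, show 4 - 3 = 1 from rfl] at h
  have h2k : (2 : k) = 0 := CharTwo.two_eq_zero
  linear_combination h - 2 * coeff 5 S * h2k

include hR h0 h2 in
/-- `T₇ = T₃² = 0`. [folklore] -/
theorem coeff_seven_eq_zero_of_riccati : coeff 7 S = 0 := by
  have h1 := coeff_one_eq_zero_of_riccati hR h0
  have h3 := coeff_three_eq_zero_of_riccati hR h0
  have h5 := coeff_five_eq_zero_of_riccati hR h0 h2
  have h := coeff_succ_mul_eq_sum_of_riccati hR 6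
  simp only [sum_range_succ, sum_range_zero, h0, h1, h2, h3, h5, mul_zero, zero_mul, add_zero, Nat.sub_zero,
    Nat.sub_self, show 6 - 1 = 5 from rfl, show 6 - 2 = 4 from rfl, show 6 - 3 = 3 from rfl, show 6 - 4 = 2 from rfl,
    show 6 - 5 = 1 from rfl] at h
  have h2k : (2 : k) = 0 := CharTwo.two_eq_zero
  linear_combination h - 3 * coeff 7 S * h2k

include hR h0 h2 in
/-- **`T₉ = T₄²`** (the only non-trivial Riccati constraint entering the wall). [folklore] -/
theorem coeff_nine_eq_sq_of_riccati : coeff 9 S = coeff 4 S ^ 2 := by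
  have h1 := coeff_one_eq_zero_of_riccati hR h0
  have h3 := coeff_three_eq_zero_of_riccati hR h0
  have h5 := coeff_five_eq_zero_of_riccati hR h0 h2
  have h7 := coeff_seven_eq_zero_of_riccati hR h0 h2
  have h := coeff_succ_mul_eq_sum_of_riccati hR 8
  simp only [sum_range_succ, sum_range_zero, h0, h1, h2, h3, h5, h7, mul_zero, zero_mul, add_zero, Nat.sub_zero,
    Nat.sub_self, show 8 - 1 = 7 from rfl, show 8 - 2 = 6 from rfl, show 8 - 3 = 5 from rfl, show 8 - 4 = 4 from rfl,
    show 8 - 5 = 3 from rfl, show 8 - 6 = 2 from rfl, show 8 - 7 = 1 from rfl] at h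
  have h2k : (2 : k) = 0 := CharTwo.two_eq_zero
  linear_combination h - 4 * coeff 9 S * h2k

include hR h0 h2 in
/-- `S = T₄t⁴ + T₆t⁶ + T₈t⁸ + T₄²t⁹ + T₁₀t¹⁰ + T₁₁t¹¹ + T₁₂t¹² + T₁₃t¹³ + O(t¹⁴)`. [folklore] -/
theorem X_pow_fourteen_dvd_sub_of_riccati :
    (X : k⟦X⟧) ^ 14 ∣ S - (C (coeff 4 S) * X ^ 4 + C (coeff 6 S) * X ^ 6 + C (coeff 8 S) * X ^ 8 + C (coeff 4 S ^ 2) * X ^ 9 +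
      C (coeff 10 S) * X ^ 10 + C (coeff 11 S) * X ^ 11 + C (coeff 12 S) * X ^ 12 + C (coeff 13 S) * X ^ 13) := by
  have h1 := coeff_one_eq_zero_of_riccati hR h0
  have h3 := coeff_three_eq_zero_of_riccati hR h0
  have h5 := coeff_five_eq_zero_of_riccati hR h0 h2
  have h7 := coeff_seven_eq_zero_of_riccati hR h0 h2
  have h9 := coeff_nine_eq_sq_of_riccati hR h0 h2
  refine X_pow_dvd_iff.mpr fun m hm => ?_
  simp only [map_sub, map_add, coeff_C_mul, coeff_X_pow]
  interval_cases m <;> simp [h0, h1, h2, h3, h5, h7, h9]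

end Riccati

/-! ## §2 `(t + t⁴θ)ⁿ + tⁿ` modulo `t¹⁴` in characteristic `2` -/

section Frobenius

variable (θ : k⟦X⟧)

/-- `(a + b)² = a² + b²` in characteristic `2`. [folklore] -/
theorem add_sq_charTwo (a b : k⟦X⟧) : (a + b) ^ 2 = a ^ 2 + b ^ 2 := by
  linear_combination (a * b) * Tilt.two_eq_zero_powerSeries (k := k)

/-- `(a + b)⁴ = a⁴ + b⁴` in characteristic `2`. [folklore] -/
theorem add_pow_four_charTwo (a b : k⟦X⟧) : (a + b) ^ 4 = a ^ 4 + b ^ 4 := by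
  rw [show (4 : ℕ) = 2 * 2 from rfl, pow_mul, add_sq_charTwo, add_sq_charTwo, ← pow_mul, ← pow_mul]

/-- `(a + b)⁸ = a⁸ + b⁸` in characteristic `2`. [folklore] -/
theorem add_pow_eight_charTwo (a b : k⟦X⟧) : (a + b) ^ 8 = a ^ 8 + b ^ 8 := by
  rw [show (8 : ℕ) = 4 * 2 from rfl, pow_mul, add_pow_four_charTwo, add_sq_charTwo, ← pow_mul, ← pow_mul]

/-- `n = 4`: `t⁴ + (t + t⁴θ)⁴ ≡ 0`. [folklore] -/
theorem levelOne_term_four : (X : k⟦X⟧) ^ 4 + (X + X ^ 4 * θ) ^ 4 = X ^ 14 * (X ^ 2 * θ ^ 4) := by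
  rw [add_pow_four_charTwo]
  linear_combination ((X : k⟦X⟧) ^ 4) * Tilt.two_eq_zero_powerSeries (k := k)

/-- `n = 6`: `t⁶ + (t + t⁴θ)⁶ ≡ θ²t¹²`. [folklore] -/
theorem levelOne_term_six :
    (X : k⟦X⟧) ^ 6 + (X + X ^ 4 * θ) ^ 6 = X ^ 12 * θ ^ 2 + X ^ 14 * (X ^ 4 * θ ^ 4 + X ^ 10 * θ ^ 6) := by
  rw [show (6 : ℕ) = 2 * 3 from rfl, pow_mul (X + X ^ 4 * θ), add_sq_charTwo]
  linear_combination ((X : k⟦X⟧) ^ 6 + X ^ 12 * θ ^ 2 + X ^ 18 * θ ^ 4) * Tilt.two_eq_zero_powerSeries (k := k)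

/-- `n = 8`: `t⁸ + (t + t⁴θ)⁸ ≡ 0`. [folklore] -/
theorem levelOne_term_eight : (X : k⟦X⟧) ^ 8 + (X + X ^ 4 * θ) ^ 8 = X ^ 14 * (X ^ 18 * θ ^ 8) := by
  rw [add_pow_eight_charTwo]
  linear_combination ((X : k⟦X⟧) ^ 8) * Tilt.two_eq_zero_powerSeries (k := k)

/-- `n = 9`: `t⁹ + (t + t⁴θ)⁹ ≡ θt¹²`. [folklore] -/
theorem levelOne_term_nine :
    (X : k⟦X⟧) ^ 9 + (X + X ^ 4 * θ) ^ 9 = X ^ 12 * θ + X ^ 14 * (X ^ 19 * θ ^ 8 + X ^ 22 * θ ^ 9) := by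
  rw [show (9 : ℕ) = 8 + 1 from rfl, pow_succ (X + X ^ 4 * θ), add_pow_eight_charTwo]
  linear_combination ((X : k⟦X⟧) ^ 9) * Tilt.two_eq_zero_powerSeries (k := k)

/-- `n = 10`: `t¹⁰ + (t + t⁴θ)¹⁰ ≡ 0`. [folklore] -/
theorem levelOne_term_ten :
    (X : k⟦X⟧) ^ 10 + (X + X ^ 4 * θ) ^ 10 = X ^ 14 * (X ^ 2 * θ ^ 2 + X ^ 20 * θ ^ 8 + X ^ 26 * θ ^ 10) := by
  rw [show (10 : ℕ) = 8 + 2 from rfl, pow_add (X + X ^ 4 * θ), add_pow_eight_charTwo, add_sq_charTwo]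
  linear_combination ((X : k⟦X⟧) ^ 10) * Tilt.two_eq_zero_powerSeries (k := k)

/-- `n = 11`: `t¹¹ + (t + t⁴θ)¹¹ ≡ 0`. [folklore] -/
theorem levelOne_term_eleven :
    (X : k⟦X⟧) ^ 11 + (X + X ^ 4 * θ) ^ 11 =
      X ^ 14 * (θ + X ^ 3 * θ ^ 2 + X ^ 6 * θ ^ 3 + X ^ 21 * θ ^ 8 + X ^ 24 * θ ^ 9 + X ^ 27 * θ ^ 10 + X ^ 30 * θ ^ 11) := by
  rw [show (11 : ℕ) = 8 + 2 + 1 from rfl, pow_succ (X + X ^ 4 * θ), pow_add (X + X ^ 4 * θ), add_pow_eight_charTwo, add_sq_charTwo]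
  linear_combination ((X : k⟦X⟧) ^ 11) * Tilt.two_eq_zero_powerSeries (k := k)

/-- `n = 12`: `t¹² + (t + t⁴θ)¹² ≡ 0`. [folklore] -/
theorem levelOne_term_twelve :
    (X : k⟦X⟧) ^ 12 + (X + X ^ 4 * θ) ^ 12 = X ^ 14 * (X ^ 10 * θ ^ 4 + X ^ 22 * θ ^ 8 + X ^ 34 * θ ^ 12) := by
  rw [show (12 : ℕ) = 8 + 4 from rfl, pow_add (X + X ^ 4 * θ), add_pow_eight_charTwo, add_pow_four_charTwo]
  linear_combination ((X : k⟦X⟧) ^ 12) * Tilt.two_eq_zero_powerSeries (k := k)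

/-- `n = 13`: `t¹³ + (t + t⁴θ)¹³ ≡ 0`. [folklore] -/
theorem levelOne_term_thirteen :
    (X : k⟦X⟧) ^ 13 + (X + X ^ 4 * θ) ^ 13 =
      X ^ 14 * (X ^ 2 * θ + X ^ 11 * θ ^ 4 + X ^ 14 * θ ^ 5 + X ^ 23 * θ ^ 8 + X ^ 26 * θ ^ 9 + X ^ 35 * θ ^ 12 + X ^ 38 * θ ^ 13) := by
  rw [show (13 : ℕ) = 8 + 4 + 1 from rfl, pow_succ (X + X ^ 4 * θ), pow_add (X + X ^ 4 * θ), add_pow_eight_charTwo,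
    add_pow_four_charTwo]
  linear_combination ((X : k⟦X⟧) ^ 13) * Tilt.two_eq_zero_powerSeries (k := k)

end Frobenius

/-! ## §3 The wall -/

section Wall

variable {S δ : k⟦X⟧} {u : k} (hR : d⁄dX k S = S * S) (h0 : coeff 0 S = 0) (h2 : coeff 2 S = 0)
  (hδ : (X : k⟦X⟧) ^ 8 ∣ δ - C u * X ^ 4)

/-- The polynomial heart of the wall: for `P = c₄t⁴ + c₆t⁶ + c₈t⁸ + c₄²t⁹ + c₁₀t¹⁰ + ⋯ + c₁₃t¹³` and `θ = ū + t⁴ε`,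
`P + P(t + t⁴θ) − (ūc₄² + ū²c₆)t¹²` is divisible by `t¹⁴` (explicit quotient). [folklore] -/
theorem levelOne_poly_identity (c₄ c₆ c₈ c₁₀ c₁₁ c₁₂ c₁₃ u : k) (θ ε : k⟦X⟧) (hθ : θ = C u + X ^ 4 * ε) :
    (C c₄ * X ^ 4 + C c₆ * X ^ 6 + C c₈ * X ^ 8 + C (c₄ ^ 2) * X ^ 9 + C c₁₀ * X ^ 10 + C c₁₁ * X ^ 11 + C c₁₂ * X ^ 12 +
        C c₁₃ * X ^ 13) +
      (C c₄ * (X + X ^ 4 * θ) ^ 4 + C c₆ * (X + X ^ 4 * θ) ^ 6 + C c₈ * (X + X ^ 4 * θ) ^ 8 + C (c₄ ^ 2) * (X + X ^ 4 * θ) ^ 9 +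
        C c₁₀ * (X + X ^ 4 * θ) ^ 10 + C c₁₁ * (X + X ^ 4 * θ) ^ 11 + C c₁₂ * (X + X ^ 4 * θ) ^ 12 + C c₁₃ * (X + X ^ 4 * θ) ^ 13) -
      C (u * c₄ ^ 2 + u ^ 2 * c₆) * X ^ 12 =
    X ^ 14 * (C c₄ * (X ^ 2 * θ ^ 4) + C c₆ * (X ^ 6 * ε ^ 2 + (X ^ 4 * θ ^ 4 + X ^ 10 * θ ^ 6)) + C c₈ * (X ^ 18 * θ ^ 8) +
      C (c₄ ^ 2) * (X ^ 2 * ε + (X ^ 19 * θ ^ 8 + X ^ 22 * θ ^ 9)) + C c₁₀ * (X ^ 2 * θ ^ 2 + X ^ 20 * θ ^ 8 + X ^ 26 * θ ^ 10) +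
      C c₁₁ * (θ + X ^ 3 * θ ^ 2 + X ^ 6 * θ ^ 3 + X ^ 21 * θ ^ 8 + X ^ 24 * θ ^ 9 + X ^ 27 * θ ^ 10 + X ^ 30 * θ ^ 11) +
      C c₁₂ * (X ^ 10 * θ ^ 4 + X ^ 22 * θ ^ 8 + X ^ 34 * θ ^ 12) +
      C c₁₃ * (X ^ 2 * θ + X ^ 11 * θ ^ 4 + X ^ 14 * θ ^ 5 + X ^ 23 * θ ^ 8 + X ^ 26 * θ ^ 9 + X ^ 35 * θ ^ 12 + X ^ 38 * θ ^ 13)) := by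
  have h2P := Tilt.two_eq_zero_powerSeries (k := k)
  have e4 := levelOne_term_four θ
  have e6 := levelOne_term_six θ
  have e8 := levelOne_term_eight θ
  have e9 := levelOne_term_nine θ
  have e10 := levelOne_term_ten θ
  have e11 := levelOne_term_eleven θ
  have e12 := levelOne_term_twelve θ
  have e13 := levelOne_term_thirteen θ
  have hθsq : X ^ 12 * θ ^ 2 = C u ^ 2 * X ^ 12 + X ^ 14 * (X ^ 6 * ε ^ 2) := by
    rw [hθ]; linear_combination (C u * X ^ 16 * ε) * h2P
  have hθ1 : X ^ 12 * θ = C u * X ^ 12 + X ^ 14 * (X ^ 2 * ε) := by rw [hθ]; ring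
  rw [map_add, map_mul, map_mul, map_pow, map_pow]
  linear_combination C c₄ * e4 + C c₆ * e6 + C c₈ * e8 + C c₄ ^ 2 * e9 + C c₁₀ * e10 + C c₁₁ * e11 + C c₁₂ * e12 +
    C c₁₃ * e13 + C c₆ * hθsq + C c₄ ^ 2 * hθ1

include hR h0 h2 hδ in
/-- **The level-one wall.**  `S' = S²`, `[t⁰]S = [t²]S = 0`, `δ ≡ ū t⁴ (mod t⁸)` ⟹
`t¹⁴ ∣ S + S(t + δ) − (ū·T₄² + ū²·T₆)·t¹²` (`T₄ = [t⁴]S`, `T₆ = [t⁶]S`) — the card's `S₁ ≡ (ūT₄² + ū²T₆)t¹² (mod t¹⁴)`. [folklore] -/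
theorem X_pow_fourteen_dvd_levelOne_sub :
    (X : k⟦X⟧) ^ 14 ∣ S + S.subst (X + δ) - C (u * coeff 4 S ^ 2 + u ^ 2 * coeff 6 S) * X ^ 12 := by
  obtain ⟨ε, hε⟩ := hδ
  obtain ⟨S', hS'⟩ := X_pow_fourteen_dvd_sub_of_riccati hR h0 h2
  -- `δ = t⁴·θ`, `θ = ū + t⁴ε`
  have hδθ : δ = X ^ 4 * (C u + X ^ 4 * ε) := by linear_combination hε
  have hδ0 : constantCoeff δ = 0 := by rw [hδθ]; simp
  have hs : HasSubst (X + δ) := Tilt.hasSubst_X_add hδ0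
  -- `S = P + t¹⁴ S'`
  have hSP : S = (C (coeff 4 S) * X ^ 4 + C (coeff 6 S) * X ^ 6 + C (coeff 8 S) * X ^ 8 + C (coeff 4 S ^ 2) * X ^ 9 +
      C (coeff 10 S) * X ^ 10 + C (coeff 11 S) * X ^ 11 + C (coeff 12 S) * X ^ 12 + C (coeff 13 S) * X ^ 13) + X ^ 14 * S' := by
    linear_combination hS'
  -- substitution is a ring map fixing constants
  have hsubS : S.subst (X + δ) = (C (coeff 4 S) * (X + δ) ^ 4 + C (coeff 6 S) * (X + δ) ^ 6 + C (coeff 8 S) * (X + δ) ^ 8 +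
      C (coeff 4 S ^ 2) * (X + δ) ^ 9 + C (coeff 10 S) * (X + δ) ^ 10 + C (coeff 11 S) * (X + δ) ^ 11 +
      C (coeff 12 S) * (X + δ) ^ 12 + C (coeff 13 S) * (X + δ) ^ 13) + (X + δ) ^ 14 * S'.subst (X + δ) := by
    conv_lhs => rw [hSP]
    rw [← coe_substAlgHom hs]
    simp only [map_add, map_mul, map_pow, C_eq_algebraMap, AlgHom.commutes]
    rw [coe_substAlgHom hs, subst_X hs]
  have hpoly := levelOne_poly_identity (coeff 4 S) (coeff 6 S) (coeff 8 S) (coeff 10 S) (coeff 11 S) (coeff 12 S) (coeff 13 S) u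
    (C u + X ^ 4 * ε) ε rfl
  have h14 : (X + δ) ^ 14 = X ^ 14 * (1 + X ^ 3 * (C u + X ^ 4 * ε)) ^ 14 := by rw [hδθ]; ring
  refine ⟨(C (coeff 4 S) * (X ^ 2 * (C u + X ^ 4 * ε) ^ 4) +
      C (coeff 6 S) * (X ^ 6 * ε ^ 2 + (X ^ 4 * (C u + X ^ 4 * ε) ^ 4 + X ^ 10 * (C u + X ^ 4 * ε) ^ 6)) +
      C (coeff 8 S) * (X ^ 18 * (C u + X ^ 4 * ε) ^ 8) +
      C (coeff 4 S ^ 2) * (X ^ 2 * ε + (X ^ 19 * (C u + X ^ 4 * ε) ^ 8 + X ^ 22 * (C u + X ^ 4 * ε) ^ 9)) +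
      C (coeff 10 S) * (X ^ 2 * (C u + X ^ 4 * ε) ^ 2 + X ^ 20 * (C u + X ^ 4 * ε) ^ 8 + X ^ 26 * (C u + X ^ 4 * ε) ^ 10) +
      C (coeff 11 S) * ((C u + X ^ 4 * ε) + X ^ 3 * (C u + X ^ 4 * ε) ^ 2 + X ^ 6 * (C u + X ^ 4 * ε) ^ 3 +
        X ^ 21 * (C u + X ^ 4 * ε) ^ 8 + X ^ 24 * (C u + X ^ 4 * ε) ^ 9 + X ^ 27 * (C u + X ^ 4 * ε) ^ 10 +
        X ^ 30 * (C u + X ^ 4 * ε) ^ 11) +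
      C (coeff 12 S) * (X ^ 10 * (C u + X ^ 4 * ε) ^ 4 + X ^ 22 * (C u + X ^ 4 * ε) ^ 8 + X ^ 34 * (C u + X ^ 4 * ε) ^ 12) +
      C (coeff 13 S) * (X ^ 2 * (C u + X ^ 4 * ε) + X ^ 11 * (C u + X ^ 4 * ε) ^ 4 + X ^ 14 * (C u + X ^ 4 * ε) ^ 5 +
        X ^ 23 * (C u + X ^ 4 * ε) ^ 8 + X ^ 26 * (C u + X ^ 4 * ε) ^ 9 + X ^ 35 * (C u + X ^ 4 * ε) ^ 12 +
        X ^ 38 * (C u + X ^ 4 * ε) ^ 13)) +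
      S' + (1 + X ^ 3 * (C u + X ^ 4 * ε)) ^ 14 * S'.subst (X + X ^ 4 * (C u + X ^ 4 * ε)), ?_⟩
  rw [hsubS, h14, hδθ]
  linear_combination hSP + hpoly

include hR h0 h2 hδ in
/-- **`[t¹²]S₁ = ūT₄² + ū²T₆`.** [folklore] -/
theorem coeff_twelve_levelOne : coeff 12 (S + S.subst (X + δ)) = u * coeff 4 S ^ 2 + u ^ 2 * coeff 6 S := by
  obtain ⟨q, hq⟩ := X_pow_fourteen_dvd_levelOne_sub hR h0 h2 hδ
  have h : S + S.subst (X + δ) = C (u * coeff 4 S ^ 2 + u ^ 2 * coeff 6 S) * X ^ 12 + X ^ 14 * q := by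
    linear_combination hq
  rw [h, map_add, coeff_C_mul, coeff_X_pow, if_pos rfl, mul_one, coeff_X_pow_mul', if_neg (by norm_num), add_zero]

include hR h0 h2 hδ in
/-- **`[t¹³]S₁ = 0`: the valuation of `S₁` is never `13`.** [folklore] -/
theorem coeff_thirteen_levelOne : coeff 13 (S + S.subst (X + δ)) = 0 := by
  obtain ⟨q, hq⟩ := X_pow_fourteen_dvd_levelOne_sub hR h0 h2 hδ
  have h : S + S.subst (X + δ) = C (u * coeff 4 S ^ 2 + u ^ 2 * coeff 6 S) * X ^ 12 + X ^ 14 * q := by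
    linear_combination hq
  rw [h, map_add, coeff_C_mul, coeff_X_pow, if_neg (by norm_num), mul_zero, coeff_X_pow_mul', if_neg (by norm_num), add_zero]

include hR h0 h2 hδ in
/-- All coefficients of `S₁` below `t¹²` vanish. [folklore] -/
theorem coeff_levelOne_eq_zero_of_lt_twelve {m : ℕ} (hm : m < 12) : coeff m (S + S.subst (X + δ)) = 0 := by
  obtain ⟨q, hq⟩ := X_pow_fourteen_dvd_levelOne_sub hR h0 h2 hδ
  have h : S + S.subst (X + δ) = C (u * coeff 4 S ^ 2 + u ^ 2 * coeff 6 S) * X ^ 12 + X ^ 14 * q := by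
    linear_combination hq
  rw [h, map_add, coeff_C_mul, coeff_X_pow, if_neg (by omega), mul_zero, coeff_X_pow_mul', if_neg (by omega), add_zero]

include hR h0 h2 hδ in
/-- **The wall dichotomy `v(S₁) ∈ {12} ∪ [14, ∞)`**: `t¹² ∣ S₁` always; `ūT₄² + ū²T₆ ≠ 0 ⟹ [t¹²]S₁ ≠ 0` (so `v(S₁) = 12`, `NonDeg(1)`);
`ūT₄² + ū²T₆ = 0 ⟹ t¹⁴ ∣ S₁` (degenerate at level `1`). [folklore] -/
theorem levelOne_dichotomy :
    (X : k⟦X⟧) ^ 12 ∣ S + S.subst (X + δ) ∧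
      (u * coeff 4 S ^ 2 + u ^ 2 * coeff 6 S ≠ 0 → coeff 12 (S + S.subst (X + δ)) ≠ 0) ∧
      (u * coeff 4 S ^ 2 + u ^ 2 * coeff 6 S = 0 → (X : k⟦X⟧) ^ 14 ∣ S + S.subst (X + δ)) := by
  refine ⟨X_pow_dvd_iff.mpr fun m hm => coeff_levelOne_eq_zero_of_lt_twelve hR h0 h2 hδ hm, fun hne => ?_, fun hz => ?_⟩
  · rwa [coeff_twelve_levelOne hR h0 h2 hδ]
  · have h := X_pow_fourteen_dvd_levelOne_sub hR h0 h2 hδ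
    rwa [hz, map_zero, zero_mul, sub_zero] at h

end Wall

end Summit.BirchSwinnertonDyer.BirchSwinnertonDyer.Theorems.SignedMuAtTwo.JetCharacterSums

end
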